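import Mathlib.Analysis.CStarAlgebra.Matrix
import Mathlib.Analysis.Matrix.Spectrum
import Mathlib.Analysis.Normed.Algebra.MatrixExponential
import Mathlib.LinearAlgebra.Eigenspace.Basic
import Mathlib.Analysis.InnerProductSpace.Projection.Basic
import Mathlib.LinearAlgebra.Matrix.Trace
import Mathlib.Analysis.Matrix.Order
import Mathlib.Analysis.Matrix.HermitianFunctionalCalculus
import Mathlib.Analysis.SpecialFunctions.ContinuousFunctionalCalculus.ExpLog.Basic
import Literature.Analysis.UnboundedOperators.SpectralGap
import Literature.MathematicalPhysics.QuantumLattice.HubbardWave0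
import HarnessLib

-- provenance: harness21/H21/H21/Prelude/QLatticeAQFT/FinDimSpectrum.lean @ 3921232 (interim HEAD d8f2665); M5 mechanical rewrite
/-!
# Finite-dimensional spectral vocabulary for Hermitian matrices

Trunk: QLatticeAQFT (Part Q, prelude item Q1 `FinDimSpectrum`; notions `spectral_gap_findim`,
`quantum_gibbs_state_findim`). Consumers: the finite-volume quantum-lattice statements of the
`hubbard` family (Lieb–Schultz–Mattis, AKLT, Michalakis–Zwolak stability, Koma–Tasaki, ...).

Following the trunk convention "operators are matrices", a finite-volume Hamiltonian is a matrix
`H : Matrix n n ℂ` acting on `n → ℂ` (or `EuclideanSpace ℂ n`) by `Matrix.mulVec`. This file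
provides

* the **ground energy / spectral gap** vocabulary `Matrix.groundEnergy`, `Matrix.spectralGap`,
  `Matrix.HasSpectralGap`, obtained by *transport* along Mathlib's star-algebra equivalence
  `Matrix.toEuclideanCLM : Matrix n n ℂ ≃⋆ₐ[ℂ] (EuclideanSpace ℂ n →L[ℂ] EuclideanSpace ℂ n)`
  from the bounded-operator vocabulary of `Literature.Prelude.UnbddOp.SpectralGap`
  (`ContinuousLinearMap.groundEnergy/spectralGap/HasSpectralGap`); the ground eigenspace
  `Matrix.groundSpace`, its dimension `Matrix.groundStateDegeneracy`, `Matrix.HasUniqueGroundState`,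
  `Matrix.IsGroundStateVector`;
* the **clustered / degenerate gap** `Matrix.HasClusterGap A m w Δ` (`m` eigenvalues, counted with
  multiplicity, in the window `[E₀, E₀ + w]`, all others `≥ E₀ + w + Δ`) and
  `Matrix.HasDegenerateGap A m Δ := ∃ w, HasClusterGap A m w Δ`, phrased through Mathlib's
  `Matrix.IsHermitian.eigenvalues` (Michalakis–Zwolak, CMP 322 (2013) §2; Bravyi–Hastings–
  Michalakis 2010). These are deliberately **not** called `HasSpectralGapAbove`:
  `LinearPMap.HasSpectralGapAbove A V E₀ Δ` of `Literature.Prelude.UnbddOp.SpectralGap` has a different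
  signature (a ground submodule `V` and energy `E₀` as arguments);
* orthogonal projections as matrices `Literature.QLattice.projMatrix K` (via Mathlib's
  `Submodule.starProjection`), the ground-state projection `Matrix.groundProj`, the (tracial)
  ground-state functional `Matrix.groundStateFunctional A : Matrix n n ℂ →ₗ[ℂ] ℂ`,
  `O ↦ tr (P O) / tr P`, and the sector energy `Matrix.minEnergyOn A K`;
* the **quantum Gibbs state** at inverse temperature `β`: `Matrix.gibbsWeight β H = e^{-βH}`
  (Mathlib's `NormedSpace.exp`), `Matrix.partitionFn β H = tr e^{-βH}`,
  `Matrix.gibbsState β H : Matrix n n ℂ →ₗ[ℂ] ℂ`, `A ↦ tr (e^{-βH} A) / Z`, and the thermal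
  two-point function `Matrix.thermalCorr β H A B = ⟨A B⟩_β`
  (Bratteli–Robinson II §5.3.1; Tasaki (2020) §2 and App. A).

Sources: H. Tasaki, *Physics and Mathematics of Quantum Many-Body Systems* (2020), §2.1–2.2 and
App. A.2; O. Bratteli–D. Robinson, *Operator Algebras and Quantum Statistical Mechanics II*,
§5.3.1; S. Michalakis–J. Zwolak, *Stability of frustration-free Hamiltonians*, CMP 322 (2013),
§2; Reed–Simon IV §XIII.1 (min–max).

## Mathlib

Used without redefinition (all grepped in the pinned source): `Matrix.toEuclideanCLM`
(`Mathlib.Analysis.CStarAlgebra.Matrix`), `Matrix.IsHermitian.eigenvalues₀/eigenvalues`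
(antitone: `Matrix.IsHermitian.eigenvalues₀_antitone`), `Module.End.eigenspace`, `Matrix.toLin'`,
`Submodule.starProjection` (+ `isSelfAdjoint_starProjection`,
`Submodule.isIdempotentElem_starProjection`), `Matrix.traceLinearMap`, `LinearMap.mulLeft`,
`NormedSpace.exp` (no field argument at this pin), `WithLp.linearEquiv`, `Matrix.PosSemidef`,
and the operator norm scope `Matrix.Norms.L2Operator`; for the proofs also `AlgEquiv.spectrum_eq`,
`Matrix.IsHermitian.spectrum_eq_image_range`, `LinearMap.IsSymmetric.card_filter_eigenvalues_eq`
(eigenvalue multiplicity = eigenspace dimension), the matrix order/C⋆-structure of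
`Mathlib.Analysis.Matrix.Order` (`IsSelfAdjoint.exp_nonneg`, `PosSemidef.posDef_iff_isUnit`,
`Matrix.isUnit_exp`) and the Hermitian functional calculus `Matrix.IsHermitian.cfc_eq`
(`e^{-βH} = U diag(e^{-βλᵢ}) U⋆`). Mathlib has no ground energy / spectral
gap / Gibbs state vocabulary for matrices (searched `groundEnergy`, `spectralGap`, `gibbs`,
`partitionF`, `Gibbs`).

## Design choices

* Declarations taking a matrix as first explicit argument are deliberate dot-notation extensions
  in Mathlib's `Matrix` namespace (trunk outline, Part Q header); `projMatrix` lives in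
  `Literature.QLattice`; the Wave0 bridge lemma lives in `Literature.Hubbard`.
* Everything is over `ℂ` and `[Fintype n] [DecidableEq n]`, the generality the consumers need
  (`IsHermitian.eigenvalues` needs `DecidableEq`; `toEuclideanCLM` needs `Fintype`).
* `groundEnergy`, `spectralGap`, `minEnergyOn` are `sInf`s with documented junk values, paired
  with the predicates `HasSpectralGap`, `HasClusterGap` (which carry hermiticity and pin `E₀`
  to an actual eigenvalue).
* `groundStateFunctional` and `gibbsState` are honest `ℂ`-linear maps `(tr P)⁻¹ • (tr ∘ (P * ·))`;
  no `sorry` in any definition.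
* This Prelude file imports the Statements file `Literature.Statements.Hubbard.Wave0` only for the bridge
  lemma `Literature.MathematicalPhysics.QuantumLattice.groundEnergy_eq_minEnergyOn` (outline §0 precedent).
-/

noncomputable section

open scoped Matrix.Norms.L2Operator ComplexOrder MatrixOrder InnerProductSpace

/-! ### Orthogonal projections as matrices -/

namespace Literature.MathematicalPhysics.QuantumLattice

open Matrix

variable {n : Type*} [Fintype n] [DecidableEq n]

/-- The matrix of the orthogonal projection onto a subspace `K ≤ ℂⁿ` (`EuclideanSpace ℂ n`):
Mathlib's `Submodule.starProjection K` transported back along `Matrix.toEuclideanCLM`.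
(Finite-dimensional subspaces are complete, so `K.HasOrthogonalProjection` is automatic.)
Tasaki (2020) App. A.2. [cite: Tasaki2020] -/
def projMatrix (K : Submodule ℂ (EuclideanSpace ℂ n)) : Matrix n n ℂ :=
  (Matrix.toEuclideanCLM (n := n) (𝕜 := ℂ)).symm K.starProjection

/-- The projection matrix onto `K` is Hermitian (`isSelfAdjoint_starProjection`). [folklore] -/
theorem projMatrix_isHermitian (K : Submodule ℂ (EuclideanSpace ℂ n)) :
    (projMatrix K).IsHermitian := by
  have h := (Matrix.toEuclideanCLM (n := n) (𝕜 := ℂ)).symm.map_star' K.starProjection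
  rw [(isSelfAdjoint_starProjection K).star_eq] at h
  exact h.symm

/-- The projection matrix onto `K` is idempotent (`Submodule.isIdempotentElem_starProjection`). [folklore] -/
theorem projMatrix_mul_self (K : Submodule ℂ (EuclideanSpace ℂ n)) :
    projMatrix K * projMatrix K = projMatrix K := by
  rw [projMatrix, ← map_mul (Matrix.toEuclideanCLM (n := n) (𝕜 := ℂ)).symm,
    K.isIdempotentElem_starProjection.eq]

/-- The projection matrix acts as the orthogonal projection: `P *ᵥ x = starProjection K x`
(transport along `Matrix.toEuclideanCLM`). [folklore] -/
theorem projMatrix_mulVec (K : Submodule ℂ (EuclideanSpace ℂ n)) (x : EuclideanSpace ℂ n) :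
    projMatrix K *ᵥ (x : n → ℂ) = (K.starProjection x : n → ℂ) := by
  have h := Matrix.ofLp_toEuclideanCLM (n := n) (𝕜 := ℂ) (projMatrix K) x
  rw [projMatrix, StarAlgEquiv.apply_symm_apply] at h
  exact h.symm

end Literature.MathematicalPhysics.QuantumLattice

/-! ### Ground energy, spectral gap, ground space -/

namespace Matrix

open Literature.MathematicalPhysics.QuantumLattice

variable {n : Type*} [Fintype n] [DecidableEq n]

/-- (Dot-notation extension of Mathlib's `Matrix`.) The *ground energy* `E₀(A) = inf re σ(A)` of
a square complex matrix, by transport along `Matrix.toEuclideanCLM` from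
`ContinuousLinearMap.groundEnergy`. For Hermitian `A` on a nonempty index type this is the
smallest eigenvalue (`groundEnergy_eq_eigenvalues₀_last`). **Junk value** `0` when `n` is empty
(empty spectrum). Tasaki (2020) §2.1; Reed–Simon IV §XIII.1. [cite: Tasaki2020] -/
def groundEnergy (A : Matrix n n ℂ) : ℝ :=
  (toEuclideanCLM (n := n) (𝕜 := ℂ) A).groundEnergy

/-- (Dot-notation extension of Mathlib's `Matrix`.) The *spectral gap*
`inf (re σ(A) ∖ {E₀}) - E₀` above the ground energy, by transport from
`ContinuousLinearMap.spectralGap`. **Junk value** `-E₀` when `σ(A) = {E₀}` (inherited); use under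
`HasSpectralGap`/`HasClusterGap`. Tasaki (2020) §2.1. [cite: Tasaki2020] -/
def spectralGap (A : Matrix n n ℂ) : ℝ :=
  (toEuclideanCLM (n := n) (𝕜 := ℂ) A).spectralGap

/-- (Dot-notation extension of Mathlib's `Matrix`.) `A.HasSpectralGap Δ`: `A` is Hermitian, its
ground energy is a *simple* eigenvalue and all other eigenvalues are `≥ E₀ + Δ`, `0 < Δ`
("unique gapped ground state"); by transport from `ContinuousLinearMap.HasSpectralGap`.
Tasaki (2020) §2.1; Reed–Simon IV §XIII.12. [cite: Tasaki2020] -/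
def HasSpectralGap (A : Matrix n n ℂ) (Δ : ℝ) : Prop :=
  (toEuclideanCLM (n := n) (𝕜 := ℂ) A).HasSpectralGap Δ

/-- (Dot-notation extension of Mathlib's `Matrix`.) The ground eigenspace
`ker (A - E₀)` of `A` acting on `n → ℂ` by `mulVec` (`Matrix.toLin'`), as a Mathlib
`Module.End.eigenspace`. It is `⊥` unless `E₀ = groundEnergy A` is an eigenvalue (always the case
for Hermitian `A`, `groundSpace_ne_bot`). Tasaki (2020) §2.1. [cite: Tasaki2020] -/
def groundSpace (A : Matrix n n ℂ) : Submodule ℂ (n → ℂ) :=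
  Module.End.eigenspace (Matrix.toLin' A) (A.groundEnergy : ℂ)

/-- (Dot-notation extension of Mathlib's `Matrix`.) The ground-state degeneracy
`dim ker (A - E₀)`. Tasaki (2020) §2.1. [cite: Tasaki2020] -/
def groundStateDegeneracy (A : Matrix n n ℂ) : ℕ :=
  Module.finrank ℂ A.groundSpace

/-- (Dot-notation extension of Mathlib's `Matrix`.) `A` has a unique (non-degenerate) ground state:
`dim ker (A - E₀) = 1`. Tasaki (2020) §2.1. [cite: Tasaki2020] -/
def HasUniqueGroundState (A : Matrix n n ℂ) : Prop :=
  A.groundStateDegeneracy = 1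

/-- (Dot-notation extension of Mathlib's `Matrix`.) `ψ` is a ground-state vector of `A`:
`ψ ≠ 0` and `A ψ = E₀ ψ`. Tasaki (2020) §2.1. [cite: Tasaki2020] -/
def IsGroundStateVector (A : Matrix n n ℂ) (ψ : n → ℂ) : Prop :=
  ψ ≠ 0 ∧ A *ᵥ ψ = (A.groundEnergy : ℂ) • ψ

/-- Membership in the ground space: `A ψ = E₀ ψ`. [folklore] -/
theorem mem_groundSpace_iff (A : Matrix n n ℂ) (ψ : n → ℂ) :
    ψ ∈ A.groundSpace ↔ A *ᵥ ψ = (A.groundEnergy : ℂ) • ψ := by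
  simp [groundSpace]

/-- A vector is a ground-state vector iff it is a nonzero element of the ground space. [folklore] -/
theorem isGroundStateVector_iff (A : Matrix n n ℂ) (ψ : n → ℂ) :
    A.IsGroundStateVector ψ ↔ ψ ≠ 0 ∧ ψ ∈ A.groundSpace := by
  rw [IsGroundStateVector, mem_groundSpace_iff]

/-! ### Clustered / degenerate spectral gap -/

/-- (Dot-notation extension of Mathlib's `Matrix`.) **Cluster gap.** `A.HasClusterGap m w Δ`:
`A` is Hermitian, `0 ≤ w`, `0 < Δ`, exactly `m` eigenvalues of `A` (counted with multiplicity,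
i.e. `m` indices of `Matrix.IsHermitian.eigenvalues`) lie in the low-energy window
`[E₀, E₀ + w]`, and every other eigenvalue is `≥ E₀ + w + Δ`, where `E₀ = ⨅ j, eigenvalues j` is
the smallest eigenvalue. This is the "gap above a cluster of `m` quasi-degenerate ground states
of energy spread `w`" of Michalakis–Zwolak, CMP 322 (2013) §2 (and Bravyi–Hastings–Michalakis,
J. Math. Phys. 51 (2010)); `w = 0` is an exactly `m`-fold degenerate gapped ground state.
Not to be confused with `LinearPMap.HasSpectralGapAbove A V E₀ Δ`
(`Literature.Prelude.UnbddOp.SpectralGap`), whose arguments are a ground submodule and energy.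
(For empty `n` the infimum is the junk value `0` and the predicate says `m = 0`.) [folklore] -/
def HasClusterGap (A : Matrix n n ℂ) (m : ℕ) (w Δ : ℝ) : Prop :=
  ∃ hA : A.IsHermitian, 0 ≤ w ∧ 0 < Δ ∧
    (Finset.univ.filter fun i => hA.eigenvalues i ≤ (⨅ j, hA.eigenvalues j) + w).card = m ∧
    ∀ i, hA.eigenvalues i ≤ (⨅ j, hA.eigenvalues j) + w ∨
      (⨅ j, hA.eigenvalues j) + w + Δ ≤ hA.eigenvalues i

/-- (Dot-notation extension of Mathlib's `Matrix`.) **Degenerate gap.** `A.HasDegenerateGap m Δ`: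
for some window width `w ≥ 0`, `A` has `m` low-lying eigenvalues in `[E₀, E₀ + w]` and a gap `Δ`
above the window (`HasClusterGap`). Michalakis–Zwolak, CMP 322 (2013) §2. See also
`LinearPMap.HasSpectralGapAbove` (different signature) in `Literature.Prelude.UnbddOp.SpectralGap`. [folklore] -/
def HasDegenerateGap (A : Matrix n n ℂ) (m : ℕ) (Δ : ℝ) : Prop :=
  ∃ w : ℝ, A.HasClusterGap m w Δ

/-- A cluster gap `Δ` may be weakened to any `0 < Δ' ≤ Δ` (same cluster). [folklore] -/
theorem HasClusterGap.mono {A : Matrix n n ℂ} {m : ℕ} {w Δ Δ' : ℝ} (h : A.HasClusterGap m w Δ)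
    (hΔ' : 0 < Δ') (hle : Δ' ≤ Δ) : A.HasClusterGap m w Δ' := by
  obtain ⟨hA, hw, -, hcard, hgap⟩ := h
  refine ⟨hA, hw, hΔ', hcard, fun i => (hgap i).imp_right fun hi => ?_⟩
  linarith

/-- The cluster gap is a property of the Hermitian matrix: the count of clustered eigenvalues is
determined, so `m` is unique. [folklore] -/
theorem HasClusterGap.isHermitian {A : Matrix n n ℂ} {m : ℕ} {w Δ : ℝ}
    (h : A.HasClusterGap m w Δ) : A.IsHermitian :=
  h.1

/-- A degenerate gap may be weakened to any `0 < Δ' ≤ Δ`. [folklore] -/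
theorem HasDegenerateGap.mono {A : Matrix n n ℂ} {m : ℕ} {Δ Δ' : ℝ} (h : A.HasDegenerateGap m Δ)
    (hΔ' : 0 < Δ') (hle : Δ' ≤ Δ) : A.HasDegenerateGap m Δ' :=
  let ⟨w, hw⟩ := h; ⟨w, hw.mono hΔ' hle⟩

/-- A unique gapped ground state is the same as a cluster of `m = 1` eigenvalue of width `w = 0`
with gap `Δ`: `A.HasSpectralGap Δ ↔ A.HasClusterGap 1 0 Δ` (both say: `A` Hermitian, `0 < Δ`,
the smallest eigenvalue is simple and the others are `≥ E₀ + Δ`; Tasaki (2020) §2.1). [cite: Tasaki2020] -/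
def hasSpectralGap_iff_hasClusterGap_one : Prop :=
  ∀ (A : Matrix n n ℂ) (Δ : ℝ),
    A.HasSpectralGap Δ ↔ A.HasClusterGap 1 0 Δ

/-! ### Eigenvalue characterisations -/

/-- A matrix has a spectral gap only if it is Hermitian (self-adjointness is transported along the
star-equivalence `toEuclideanCLM`). [folklore] -/
theorem HasSpectralGap.isHermitian {A : Matrix n n ℂ} {Δ : ℝ} (h : A.HasSpectralGap Δ) :
    A.IsHermitian := by
  have h1 : IsSelfAdjoint (toEuclideanCLM (n := n) (𝕜 := ℂ) A) := h.1
  have h2 : toEuclideanCLM (n := n) (𝕜 := ℂ) (star A) =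
      star (toEuclideanCLM (n := n) (𝕜 := ℂ) A) :=
    (toEuclideanCLM (n := n) (𝕜 := ℂ)).map_star' A
  rw [h1.star_eq] at h2
  exact (toEuclideanCLM (n := n) (𝕜 := ℂ)).injective h2

/-- A spectral gap `Δ` may be weakened to any `0 < Δ' ≤ Δ`
(`ContinuousLinearMap.HasSpectralGap.anti`). [folklore] -/
theorem HasSpectralGap.anti {A : Matrix n n ℂ} {Δ Δ' : ℝ} (h : A.HasSpectralGap Δ)
    (hΔ' : 0 < Δ') (hle : Δ' ≤ Δ) : A.HasSpectralGap Δ' :=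
  ContinuousLinearMap.HasSpectralGap.anti h hΔ' hle

/-- For a Hermitian matrix the ground energy is the infimum (minimum) of the eigenvalues.
Tasaki (2020) §2.1. [cite: Tasaki2020] -/
def groundEnergy_eq_iInf_eigenvalues : Prop :=
  ∀ {A : Matrix n n ℂ} (hA : A.IsHermitian),
    A.groundEnergy = ⨅ i, hA.eigenvalues i

/-- The spectrum of `A` as a bounded operator on `EuclideanSpace ℂ n` is the spectrum of `A`
(Mathlib `AlgEquiv.spectrum_eq` for the star-algebra equivalence `toEuclideanCLM`). [folklore] -/
theorem spectrum_toEuclideanCLM (A : Matrix n n ℂ) :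
    spectrum ℂ (toEuclideanCLM (n := n) (𝕜 := ℂ) A) = spectrum ℂ A :=
  AlgEquiv.spectrum_eq _ A

/-- Discharge of the named fact `groundEnergy_eq_iInf_eigenvalues`: the spectrum of a Hermitian
matrix is the range of its eigenvalues (Mathlib `Matrix.IsHermitian.spectrum_eq_image_range`), so
`inf re σ(A) = ⨅ i, λᵢ`. [folklore] -/
theorem groundEnergy_eq_iInf_eigenvalues_holds : groundEnergy_eq_iInf_eigenvalues (n := n) := by
  intro A hA
  rw [groundEnergy, ContinuousLinearMap.groundEnergy, spectrum_toEuclideanCLM,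
    hA.spectrum_eq_image_range, Set.image_image, ← sInf_range]
  congr 1
  ext x
  simp

/-- For a Hermitian matrix on `k + 1` basis states the ground energy is the *last* sorted
eigenvalue `eigenvalues₀ (Fin.last k)` (Mathlib sorts `eigenvalues₀` in decreasing order,
`Matrix.IsHermitian.eigenvalues₀_antitone`). Tasaki (2020) §2.1. [cite: Tasaki2020] -/
def groundEnergy_eq_eigenvalues₀_last : Prop :=
  ∀ {A : Matrix n n ℂ} (hA : A.IsHermitian) {k : ℕ} (hn : Fintype.card n = k + 1),
    A.groundEnergy = hA.eigenvalues₀ (Fin.cast hn.symm (Fin.last k))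

/-- Every eigenvalue is at least the ground energy (`groundEnergy_eq_iInf_eigenvalues_holds` and
`ciInf_le`; the range of the eigenvalues is finite, hence bounded below). [folklore] -/
theorem groundEnergy_le_eigenvalues {A : Matrix n n ℂ} (hA : A.IsHermitian) (i : n) :
    A.groundEnergy ≤ hA.eigenvalues i := by
  rw [groundEnergy_eq_iInf_eigenvalues_holds hA]
  exact ciInf_le (Set.finite_range _).bddBelow i

/-- Eigenvalue form of the spectral gap on `k + 2` basis states: `A.HasSpectralGap Δ` iff
`0 < Δ` and (lowest eigenvalue) `+ Δ ≤` (second lowest eigenvalue), in terms of the decreasingly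
sorted `eigenvalues₀` (`LinearMap.IsSymmetric.hasSpectralGap_toContinuousLinearMap_iff` of
`Literature.Prelude.UnbddOp.SpectralGap`, transported). Tasaki (2020) §2.1. [cite: Tasaki2020] -/
def hasSpectralGap_iff_eigenvalues₀ : Prop :=
  ∀ {A : Matrix n n ℂ} (hA : A.IsHermitian) {k : ℕ} (hn : Fintype.card n = k + 2) (Δ : ℝ),
    A.HasSpectralGap Δ ↔
      0 < Δ ∧ hA.eigenvalues₀ (Fin.cast hn.symm (Fin.last (k + 1))) + Δ ≤
        hA.eigenvalues₀ (Fin.cast hn.symm (Fin.castSucc (Fin.last k)))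

/-- Variational principle: the ground energy of a Hermitian matrix is a lower bound for the
Rayleigh quotient, `E₀ ≤ ⟨ψ, A ψ⟩` for every unit vector `ψ`. Tasaki (2020) §2.1, (2.1.6);
Reed–Simon IV, Theorem XIII.1. [cite: Tasaki2020] -/
def groundEnergy_le_rayleigh : Prop :=
  ∀ {A : Matrix n n ℂ} (hA : A.IsHermitian) (ψ : n → ℂ) (hψ : star ψ ⬝ᵥ ψ = 1),
    A.groundEnergy ≤ (star ψ ⬝ᵥ A *ᵥ ψ).re

/-- The Rayleigh quotient attains the ground energy exactly on the ground space.
Tasaki (2020) §2.1. [cite: Tasaki2020] -/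
def rayleigh_eq_groundEnergy_iff : Prop :=
  ∀ {A : Matrix n n ℂ} (hA : A.IsHermitian) (ψ : n → ℂ) (hψ : star ψ ⬝ᵥ ψ = 1),
    (star ψ ⬝ᵥ A *ᵥ ψ).re = A.groundEnergy ↔ ψ ∈ A.groundSpace

/-- A Hermitian matrix on a nonempty index type has a ground state. Tasaki (2020) §2.1. [cite: Tasaki2020] -/
def groundSpace_ne_bot : Prop :=
  ∀ {A : Matrix n n ℂ} (hA : A.IsHermitian) [Nonempty n],
    A.groundSpace ≠ ⊥

/-- The eigenspace of `A` on `EuclideanSpace ℂ n` (`toEuclideanLin`) is the image of the eigenspace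
of `A` on `n → ℂ` (`toLin'`) under `(WithLp.linearEquiv 2 ℂ (n → ℂ)).symm`. [folklore] -/
theorem eigenspace_toEuclideanLin_eq_map (A : Matrix n n ℂ) (μ : ℂ) :
    Module.End.eigenspace (toEuclideanLin A) μ =
      (Module.End.eigenspace (toLin' A) μ).map
        ((WithLp.linearEquiv 2 ℂ (n → ℂ)).symm : (n → ℂ) →ₗ[ℂ] EuclideanSpace ℂ n) := by
  ext x
  simp only [Module.End.mem_eigenspace_iff, Submodule.mem_map_equiv, LinearEquiv.symm_symm,
    toLin'_apply, WithLp.linearEquiv_apply]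
  constructor
  · intro h
    have := congrArg WithLp.ofLp h
    simpa [ofLp_toLpLin] using this
  · intro h
    apply WithLp.ofLp_injective 2
    simpa [ofLp_toLpLin] using h

/-- The eigenspaces of `A` on `EuclideanSpace ℂ n` and on `n → ℂ` have the same dimension
(`eigenspace_toEuclideanLin_eq_map`, `LinearEquiv.finrank_map_eq`). [folklore] -/
theorem finrank_eigenspace_toEuclideanLin (A : Matrix n n ℂ) (μ : ℂ) :
    Module.finrank ℂ (Module.End.eigenspace (toEuclideanLin A) μ) =
      Module.finrank ℂ (Module.End.eigenspace (toLin' A) μ) := by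
  rw [eigenspace_toEuclideanLin_eq_map]
  exact LinearEquiv.finrank_map_eq _ _

/-- Multiplicity of an eigenvalue of a Hermitian matrix: the number of indices `i` with `λᵢ = μ`
is the dimension of the eigenspace `ker (A - μ)` (Mathlib
`LinearMap.IsSymmetric.card_filter_eigenvalues_eq`, reindexed along the definition of
`Matrix.IsHermitian.eigenvalues` and transported to `n → ℂ`). [folklore] -/
theorem IsHermitian.card_filter_eigenvalues_eq {A : Matrix n n ℂ} (hA : A.IsHermitian) (μ : ℝ) :
    (Finset.univ.filter fun i => hA.eigenvalues i = μ).card =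
      Module.finrank ℂ (Module.End.eigenspace (toLin' A) (μ : ℂ)) := by
  rw [← finrank_eigenspace_toEuclideanLin,
    ← (isSymmetric_toEuclideanLin_iff.mpr hA).card_filter_eigenvalues_eq finrank_euclideanSpace
      (μ : ℂ)]
  refine Finset.card_equiv (Fintype.equivOfCardEq (Fintype.card_fin _)).symm fun i => ?_
  simp only [Finset.mem_filter, Finset.mem_univ, true_and, IsHermitian.eigenvalues,
    IsHermitian.eigenvalues₀]
  exact RCLike.ofReal_inj.symm

/-- A gapped matrix in the sense of `HasSpectralGap` has a unique ground state (the `finrank = 1`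
conjunct, transported from `EuclideanSpace ℂ n` to `n → ℂ` by
`finrank_eigenspace_toEuclideanLin`). [folklore] -/
theorem HasSpectralGap.hasUniqueGroundState {A : Matrix n n ℂ} {Δ : ℝ} (h : A.HasSpectralGap Δ) :
    A.HasUniqueGroundState := by
  have h1 := h.2.2.1
  rw [HasUniqueGroundState, groundStateDegeneracy, groundSpace, ← finrank_eigenspace_toEuclideanLin]
  exact h1

/-- Under a cluster gap of width `0` the cluster is the ground space: `m = groundStateDegeneracy`
(Michalakis–Zwolak, CMP 322 (2013) §2; here from `IsHermitian.card_filter_eigenvalues_eq` and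
`groundEnergy_eq_iInf_eigenvalues_holds`: the indices with `λᵢ ≤ E₀` are those with
`λᵢ = E₀`). [folklore] -/
theorem HasClusterGap.groundStateDegeneracy_eq {A : Matrix n n ℂ} {m : ℕ} {Δ : ℝ}
    (h : A.HasClusterGap m 0 Δ) : A.groundStateDegeneracy = m := by
  obtain ⟨hA, -, -, hcard, -⟩ := h
  rw [groundStateDegeneracy, groundSpace, groundEnergy_eq_iInf_eigenvalues_holds hA,
    ← hA.card_filter_eigenvalues_eq, ← hcard]
  congr 1
  ext i
  simp only [Finset.mem_filter, Finset.mem_univ, true_and, add_zero]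
  exact ⟨le_of_eq, fun h => le_antisymm h (ciInf_le (Set.finite_range _).bddBelow i)⟩

/-! ### Ground-state projection, ground-state functional, sector energies -/

/-- (Dot-notation extension of Mathlib's `Matrix`.) The orthogonal projection `P₀` onto the ground
space of `A`, as a matrix (`projMatrix` of `groundSpace A` transported to `EuclideanSpace ℂ n`
along `WithLp.linearEquiv`). Tasaki (2020) §2.1, App. A.2. [cite: Tasaki2020] -/
def groundProj (A : Matrix n n ℂ) : Matrix n n ℂ :=
  projMatrix (A.groundSpace.map ((WithLp.linearEquiv 2 ℂ (n → ℂ)).symm : (n → ℂ) →ₗ[ℂ] _))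

/-- (Dot-notation extension of Mathlib's `Matrix`.) The (tracial) ground-state functional
`O ↦ tr (P₀ O) / tr P₀`, `P₀ = groundProj A`: the uniform mixture of ground states, i.e. the
zero-temperature limit of the Gibbs state (`tendsto_gibbsState_atTop`). For a unique ground
state `Ω` it is `O ↦ ⟨Ω, O Ω⟩`. Junk value `0` when `n` is empty (`tr P₀ = 0`, `0⁻¹ = 0`).
Tasaki (2020) §2.1; Bratteli–Robinson II §5.3.1. [cite: Tasaki2020] -/
def groundStateFunctional (A : Matrix n n ℂ) : Matrix n n ℂ →ₗ[ℂ] ℂ :=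
  (A.groundProj.trace)⁻¹ • (Matrix.traceLinearMap n ℂ ℂ ∘ₗ LinearMap.mulLeft ℂ A.groundProj)

/-- Unfolding lemma for `groundStateFunctional`. [folklore] -/
theorem groundStateFunctional_apply (A O : Matrix n n ℂ) :
    A.groundStateFunctional O = (A.groundProj.trace)⁻¹ * (A.groundProj * O).trace :=
  rfl

/-- (Dot-notation extension of Mathlib's `Matrix`.) The lowest energy of `A` in the sector
(subspace) `K ≤ (n → ℂ)`: `inf {re ⟨ψ, A ψ⟩ | ψ ∈ K, ‖ψ‖ = 1}`. For Hermitian `A` commuting with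
the projection onto `K` this is the smallest eigenvalue of `A|_K`. **Junk value** `sInf ∅ = 0`
when `K = ⊥`. Lieb (1989); Tasaki (2020) §2.2. [cite: Lieb1989] -/
def minEnergyOn (A : Matrix n n ℂ) (K : Submodule ℂ (n → ℂ)) : ℝ :=
  sInf {E : ℝ | ∃ ψ ∈ K, star ψ ⬝ᵥ ψ = 1 ∧ E = (star ψ ⬝ᵥ A *ᵥ ψ).re}

/-- On the whole space the sector energy is the ground energy (variational principle,
Tasaki (2020) §2.1, (2.1.6)); requires `n` nonempty (else both sides are junk, but different
`sInf`s). [cite: Tasaki2020] -/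
def minEnergyOn_top : Prop :=
  ∀ {A : Matrix n n ℂ} (hA : A.IsHermitian) [Nonempty n],
    A.minEnergyOn ⊤ = A.groundEnergy

/-! ### Quantum Gibbs states -/

/-- (Dot-notation extension of Mathlib's `Matrix`.) The Gibbs weight `e^{-βH}` (Mathlib's
`NormedSpace.exp` in the `L2Operator` normed algebra structure; the value does not depend on the
norm). Bratteli–Robinson II §5.3.1; Tasaki (2020) App. A. [cite: Tasaki2020] -/
def gibbsWeight (β : ℝ) (H : Matrix n n ℂ) : Matrix n n ℂ :=
  NormedSpace.exp (-(β : ℂ) • H)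

/-- (Dot-notation extension of Mathlib's `Matrix`.) The partition function `Z(β) = tr e^{-βH}`.
Bratteli–Robinson II §5.3.1. [folklore] -/
def partitionFn (β : ℝ) (H : Matrix n n ℂ) : ℂ :=
  (gibbsWeight β H).trace

/-- (Dot-notation extension of Mathlib's `Matrix`.) The Gibbs state `A ↦ tr (e^{-βH} A) / Z(β)`
at inverse temperature `β`, as a `ℂ`-linear functional on observables. Junk value `0` if
`Z(β) = 0` (only for empty `n` when `H` is Hermitian, `partitionFn_pos`).
Bratteli–Robinson II §5.3.1, (5.3.2); Tasaki (2020) App. A. [cite: Tasaki2020] -/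
def gibbsState (β : ℝ) (H : Matrix n n ℂ) : Matrix n n ℂ →ₗ[ℂ] ℂ :=
  (partitionFn β H)⁻¹ • (Matrix.traceLinearMap n ℂ ℂ ∘ₗ LinearMap.mulLeft ℂ (gibbsWeight β H))

/-- (Dot-notation extension of Mathlib's `Matrix`.) The thermal two-point function
`⟨A B⟩_β = tr (e^{-βH} A B) / Z(β)` (Koma–Tasaki 1992; Bratteli–Robinson II §5.3.1). [cite: KomaTasaki1992] -/
def thermalCorr (β : ℝ) (H A B : Matrix n n ℂ) : ℂ :=
  gibbsState β H (A * B)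

/-- Unfolding lemma for `gibbsState`. [folklore] -/
theorem gibbsState_apply (β : ℝ) (H A : Matrix n n ℂ) :
    gibbsState β H A = (partitionFn β H)⁻¹ * (gibbsWeight β H * A).trace :=
  rfl

/-- At `β = 0` the Gibbs weight is the identity. [folklore] -/
@[simp]
theorem gibbsWeight_zero (H : Matrix n n ℂ) : gibbsWeight 0 H = 1 := by
  simp [gibbsWeight, NormedSpace.exp_zero]

omit [Fintype n] [DecidableEq n] in
/-- `-β H` is Hermitian for real `β` and Hermitian `H`. [folklore] -/
theorem isHermitian_neg_smul (β : ℝ) {H : Matrix n n ℂ} (hH : H.IsHermitian) :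
    (-(β : ℂ) • H).IsHermitian := by
  rw [IsHermitian, conjTranspose_smul, hH.eq]
  simp

/-- The Gibbs weight of a Hermitian Hamiltonian is Hermitian (Mathlib `Matrix.IsHermitian.exp`).
Bratteli–Robinson II §5.3.1. [folklore] -/
theorem isHermitian_gibbsWeight (β : ℝ) {H : Matrix n n ℂ} (hH : H.IsHermitian) :
    (gibbsWeight β H).IsHermitian :=
  (isHermitian_neg_smul β hH).exp

/-- The Gibbs weight of a Hermitian Hamiltonian is positive definite: `e^{-βH} ≥ 0` by the
functional calculus (Mathlib `IsSelfAdjoint.exp_nonneg`) and `e^{-βH}` is invertible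
(`Matrix.isUnit_exp`, `PosSemidef.posDef_iff_isUnit`). Bratteli–Robinson II §5.3.1. [folklore] -/
theorem posDef_gibbsWeight (β : ℝ) {H : Matrix n n ℂ} (hH : H.IsHermitian) :
    (gibbsWeight β H).PosDef := by
  have hs : IsSelfAdjoint (-(β : ℂ) • H) := (isHermitian_neg_smul β hH).isSelfAdjoint
  have h0 : (0 : Matrix n n ℂ) ≤ gibbsWeight β H := hs.exp_nonneg
  exact (Matrix.nonneg_iff_posSemidef.mp h0).posDef_iff_isUnit.mpr (Matrix.isUnit_exp _)

/-- The partition function of a Hermitian Hamiltonian on a nonempty index type is positive,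
`Z(β) = tr e^{-βH} > 0` (trace of a positive definite matrix, `Matrix.PosDef.trace_pos`).
Bratteli–Robinson II §5.3.1. [folklore] -/
theorem partitionFn_pos (β : ℝ) {H : Matrix n n ℂ} (hH : H.IsHermitian) [Nonempty n] :
    0 < partitionFn β H :=
  (posDef_gibbsWeight β hH).trace_pos

/-- The partition function as a sum over eigenvalues, `Z(β) = ∑ᵢ e^{-β Eᵢ}`: by the Hermitian
functional calculus `e^{-βH} = cfc (x ↦ e^{-βx}) H = U diag(e^{-βλᵢ}) U⋆` (Mathlib
`CFC.real_exp_eq_normedSpace_exp`, `cfc_comp_smul`, `Matrix.IsHermitian.cfc_eq`) and cyclicity of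
the trace. Bratteli–Robinson II §5.3.1. [folklore] -/
theorem partitionFn_eq_sum_exp (β : ℝ) {H : Matrix n n ℂ} (hH : H.IsHermitian) :
    partitionFn β H = ∑ i, (Real.exp (-β * hH.eigenvalues i) : ℂ) := by
  have hs : IsSelfAdjoint H := hH.isSelfAdjoint
  have hsmul : (-(β : ℂ) • H : Matrix n n ℂ) = (-β : ℝ) • H := by
    ext i j
    simp [Matrix.smul_apply, Complex.real_smul]
  have h1 : gibbsWeight β H = cfc (fun x : ℝ => Real.exp ((-β) • x)) H := by
    rw [gibbsWeight, hsmul, cfc_comp_smul (-β) Real.exp H, CFC.real_exp_eq_normedSpace_exp]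
  rw [partitionFn, h1, hH.cfc_eq, IsHermitian.cfc, Unitary.conjStarAlgAut_apply, trace_mul_cycle,
    Unitary.coe_star_mul_self, one_mul, trace_diagonal]
  simp [smul_eq_mul]

/-- The Gibbs state is normalised, `⟨1⟩_β = 1`, whenever `Z(β) ≠ 0`. [folklore] -/
theorem gibbsState_one (β : ℝ) (H : Matrix n n ℂ) (hZ : partitionFn β H ≠ 0) :
    gibbsState β H 1 = 1 := by
  rw [gibbsState_apply, mul_one, ← partitionFn, inv_mul_cancel₀ hZ]

/-- The Gibbs state of a Hermitian Hamiltonian is positive: `⟨A⟩_β ≥ 0` for `A ≥ 0` (write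
`e^{-βH} = B⋆ B`; then `tr (B⋆ B A) = tr (B A B⋆) ≥ 0` and `Z(β) ≥ 0` is real).
Bratteli–Robinson II §5.3.1. [folklore] -/
theorem gibbsState_nonneg_of_posSemidef (β : ℝ) {H : Matrix n n ℂ} (hH : H.IsHermitian)
    {A : Matrix n n ℂ} (hA : A.PosSemidef) : 0 ≤ gibbsState β H A := by
  have hW := (posDef_gibbsWeight β hH).posSemidef
  obtain ⟨B, hB⟩ := CStarAlgebra.nonneg_iff_eq_star_mul_self.mp hW.nonneg
  rw [gibbsState_apply]
  refine mul_nonneg ?_ ?_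
  · have hZ : 0 ≤ partitionFn β H := hW.trace_nonneg
    obtain ⟨hre, him⟩ := Complex.nonneg_iff.mp hZ
    rw [Complex.nonneg_iff]
    simp [Complex.inv_re, Complex.inv_im, ← him, div_nonneg, hre, Complex.normSq_nonneg]
  · rw [hB, star_eq_conjTranspose, mul_assoc, trace_mul_comm]
    exact (hA.mul_mul_conjTranspose_same B).trace_nonneg

/-- The Gibbs state of a Hermitian Hamiltonian is Hermitian: `⟨Aᴴ⟩_β = conj ⟨A⟩_β`
(`e^{-βH}` is Hermitian, `tr Xᴴ = conj (tr X)` and cyclicity). Bratteli–Robinson II §5.3.1. [folklore] -/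
theorem gibbsState_conjTranspose (β : ℝ) {H : Matrix n n ℂ} (hH : H.IsHermitian)
    (A : Matrix n n ℂ) : gibbsState β H Aᴴ = star (gibbsState β H A) := by
  have hW : (gibbsWeight β H)ᴴ = gibbsWeight β H := (isHermitian_gibbsWeight β hH).eq
  rw [gibbsState_apply, gibbsState_apply, star_mul', star_inv₀, partitionFn,
    ← trace_conjTranspose, ← trace_conjTranspose, conjTranspose_mul, hW, trace_mul_comm]

/-- The Gibbs weight commutes with the Hamiltonian (`Commute.exp_right`), hence the Gibbs state is
stationary: `⟨H A⟩_β = ⟨A H⟩_β` (cyclicity of the trace; no hermiticity needed).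
Bratteli–Robinson II §5.3.1. [folklore] -/
theorem gibbsState_hamiltonian_mul (β : ℝ) (H A : Matrix n n ℂ) :
    gibbsState β H (H * A) = gibbsState β H (A * H) := by
  have hc : Commute H (gibbsWeight β H) :=
    ((Commute.refl H).smul_right (-(β : ℂ))).exp_right
  rw [gibbsState_apply, gibbsState_apply, ← mul_assoc, ← hc.eq, mul_assoc, trace_mul_comm,
    mul_assoc]

/-- Zero-temperature limit: as `β → ∞` the Gibbs state of a Hermitian Hamiltonian converges to
the tracial ground-state functional `O ↦ tr (P₀ O) / tr P₀`. Tasaki (2020) App. A;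
Bratteli–Robinson II §5.3.1. [cite: Tasaki2020] -/
def tendsto_gibbsState_atTop : Prop :=
  ∀ {H : Matrix n n ℂ} (hH : H.IsHermitian) [Nonempty n] (A : Matrix n n ℂ),
    Filter.Tendsto (fun β : ℝ => gibbsState β H A) Filter.atTop
      (nhds (H.groundStateFunctional A))

end Matrix

/-! ### Bridge to the wave-0 Hubbard ground energy -/

namespace Literature.MathematicalPhysics.QuantumLattice

/-- Bridge to `Literature.Statements.Hubbard.Wave0`: the wave-0 sector ground energy
`Literature.Hubbard.groundEnergy H N` (infimum of `re ⟨ψ, H ψ⟩` over unit `N`-particle vectors) is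
`Matrix.minEnergyOn H K` for any submodule `K` of the Fock space whose carrier is the `N`-particle
sector (`Literature.Hubbard.IsNParticle N`; the submodule itself, `nParticleSubmodule N`, is built in
the `FermionOperators` prelude file). Lieb, PRL 62 (1989) 1201, §2. [folklore] -/
theorem groundEnergy_eq_minEnergyOn {ι : Type*} [LinearOrder ι] [Fintype ι]
    (H : Matrix (Finset ι) (Finset ι) ℂ) (N : ℕ) (K : Submodule ℂ (Fock ι))
    (hK : ∀ ψ, ψ ∈ K ↔ IsNParticle N ψ) : groundEnergy H N = H.minEnergyOn K := by
  simp only [groundEnergy, Matrix.minEnergyOn, expect, hK]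

end Literature.MathematicalPhysics.QuantumLattice
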